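import Summits.AtomisticToContinuum.BoseEinsteinCondensation.Theorems.BECConjugateDominationHardCoreExtensionAlphaPhysCutState
import Summits.AtomisticToContinuum.BoseEinsteinCondensation.Theorems.BECConjugateDominationHardCoreExtensionAlphaPairBookkeeping
import Summits.AtomisticToContinuum.BoseEinsteinCondensation.Theorems.BECConjugateDominationHardCoreExtensionPairCutoff
import Summits.AtomisticToContinuum.BoseEinsteinCondensation.Theorems.BECConjugateDominationHardCoreExtensionGramSchmidtPair
import Summits.AtomisticToContinuum.BoseEinsteinCondensation.Theorems.BECConjugateDominationHardCoreExtensionCutStatesOverlap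
import Summits.AtomisticToContinuum.BoseEinsteinCondensation.Theorems.BECConjugateDominationHardCoreExtensionTraceCauchy
import HarnessLib

/-!
# (α'₂) truncation convergence of the Ky Fan two-level at hard cores — the assembly
# (line `third-law-current-floor`, crux `HardCoreExtension`, stmt-AtomisticToContinuum-11786, lead c1, cycle 2)

For an admissible `v` with `v = ⊤` on `[0,a)` and `v ≤ M < ⊤` on `(a,∞)`, every `N`, every `L > 4a` with
`K₂(v) = kyFanTwo v N L < ⊤` and every `ε > 0`: `K₂(v) ≤ K₂(min(v,n)) + ε` for all large `n`
(`stub_truncationKyFanConvergencePhys_of`, registered node), from two inputs taken as hypotheses — kinetic tightness of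
near-optimal pairs along the truncations (conclusion of `stub_pairKineticTightness_of`) and the pair-shell mass bound
(`stub_pairShellMassBoundV2`) — and three landed ones: the pair cut-off `stub_pairCutoffExists`, Gram–Schmidt with energy
control `stub_gramSchmidtPair`, the overlap of two cut states `stub_cutStatesOverlap`. Proof: cut a `1/(m+1)`-optimal
orthogonal pair of the `m`-th truncation off the hard set by `χ` (`AlphaPhys.cutState_form_le`, `one_le_mass_cutState_add`,
`mass_cutState_le_one`, `mul_coreMass_le_energy`), re-orthonormalise, compare with `K₂(v)` by the variational principle, and
close the `ε`-bookkeeping (`AlphaPair.eta_bound_ennreal`, `AlphaPair.final_ennreal`). With a Ky Fan gap of `v` itself (S5'')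
and `stub_truncationGapOfLimitGap` this yields the uniform truncation gap (β') on the physical class. [folklore; Lean route new]
-/

noncomputable section

namespace Summit.AtomisticToContinuum.BoseEinsteinCondensation.Cruxes.HardCoreExtension.ThirdLawCurrentFloor

open MeasureTheory Filter
open scoped ENNReal NNReal BigOperators Topology ComplexConjugate
open Literature.MathematicalPhysics.QuantumManyBody.BoseGas
open AlphaPhys TraceCauchy

namespace AlphaPair

variable {N : ℕ} {L : ℝ}

/-! ### Near-optimal pairs -/

/-- Near-optimal orthogonal pairs exist when the Ky Fan level is finite. [folklore] -/
theorem exists_pair_le_add {w : ℝ → ℝ≥0∞} (hK : kyFanTwo w N L ≠ ⊤) {δ : ℝ≥0∞} (hδ : δ ≠ 0) :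
    ∃ Ψ₁ Ψ₂ : PeriodicTrialState N L, (∫ X in cellN N L, conj (Ψ₁.ψ X) * Ψ₂.ψ X = 0) ∧
      periodicEnergy w Ψ₁ + periodicEnergy w Ψ₂ ≤ kyFanTwo w N L + δ := by
  have hlt : kyFanTwo w N L < kyFanTwo w N L + δ := ENNReal.lt_add_right hK hδ
  set c := kyFanTwo w N L + δ with hc
  unfold kyFanTwo at hlt
  obtain ⟨Ψ₁, h₁⟩ := iInf_lt_iff.1 hlt
  obtain ⟨Ψ₂, h₂⟩ := iInf_lt_iff.1 h₁
  obtain ⟨horth, h₃⟩ := iInf_lt_iff.1 h₂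
  exact ⟨Ψ₁, Ψ₂, horth, h₃.le⟩

end AlphaPair

open AlphaPair

/-! ### The assembly -/

/-- **(α'₂) on the physical hard-core class, closed modulo two inputs** — registered composition node of the line
`third-law-current-floor`: the kinetic tightness of near-optimal pairs along the truncations (the conclusion of
`stub_pairKineticTightness_of`) and the pair-shell mass bound (`stub_pairShellMassBoundV2`) imply — with the LANDED pair
cut-off `stub_pairCutoffExists`, Gram–Schmidt lemma `stub_gramSchmidtPair` and cut-states overlap `stub_cutStatesOverlap` —
the truncation convergence from below of the Ky Fan two-level at hard-core-type potentials. [folklore] -/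
theorem stub_truncationKyFanConvergencePhys_of :
    (∀ (v : ℝ → ℝ≥0∞), Measurable v → ∀ (N : ℕ) (L : ℝ), 0 < L → ∀ B : ℝ≥0∞, B ≠ ⊤ →
      ∀ Ψ₁ Ψ₂ : ℕ → PeriodicTrialState N L,
        (∀ n : ℕ, ∫ X in cellN N L, conj ((Ψ₁ n).ψ X) * (Ψ₂ n).ψ X = 0) →
        (∀ n : ℕ, periodicEnergy (fun r => min (v r) (n : ℝ≥0∞)) (Ψ₁ n) +
            periodicEnergy (fun r => min (v r) (n : ℝ≥0∞)) (Ψ₂ n) ≤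
          kyFanTwo (fun r => min (v r) (n : ℝ≥0∞)) N L + ENNReal.ofReal (1 / ((n : ℝ) + 1))) →
        (∀ n : ℕ, kyFanTwo (fun r => min (v r) (n : ℝ≥0∞)) N L ≤ B) →
        ∃ φ : ℕ → ℕ, StrictMono φ ∧
          ∀ S : ℕ → Set (Config N), (∀ k, MeasurableSet (S k)) → Antitone S →
            volume ((⋂ k, S k) ∩ cellN N L) = 0 →
            ∀ ε : ℝ, 0 < ε → ∃ k₀ i₀ : ℕ, ∀ k i : ℕ, k₀ ≤ k → i₀ ≤ i →
              ∫⁻ X in S k ∩ cellN N L, kineticDensity (Ψ₁ (φ i)).ψ X + kineticDensity (Ψ₂ (φ i)).ψ X ≤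
                ENNReal.ofReal ε) →
    (∀ (N : ℕ) (L a : ℝ), 0 < L → 0 < a → 4 * a < L → ∃ C : ℝ, 0 ≤ C ∧ ∀ ℓ : ℝ, 0 < ℓ → ℓ ≤ a →
      ∀ Ψ : Config N → ℂ, ContDiff ℝ 1 Ψ →
        (∀ (X : Config N) (i : Fin N) (k : Fin 3), Ψ (X + Pi.single i (EuclideanSpace.single k L)) = Ψ X) →
        ∫⁻ X in {X : Config N | ∃ i j : Fin N, i ≠ j ∧ ∃ n : Fin 3 → ℤ,
            a < ‖X i - X j - latticeVec L n‖ ∧ ‖X i - X j - latticeVec L n‖ < a + ℓ} ∩ cellN N L,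
            (‖Ψ X‖₊ : ℝ≥0∞) ^ 2 ≤
          ENNReal.ofReal C *
              (∫⁻ X in {X : Config N | ∃ i j : Fin N, i ≠ j ∧ ∃ n : Fin 3 → ℤ,
                  a - ℓ < ‖X i - X j - latticeVec L n‖ ∧ ‖X i - X j - latticeVec L n‖ ≤ a} ∩ cellN N L,
                  (‖Ψ X‖₊ : ℝ≥0∞) ^ 2) +
            ENNReal.ofReal (C * ℓ ^ 2) *
              ∫⁻ X in {X : Config N | ∃ i j : Fin N, i ≠ j ∧ ∃ n : Fin 3 → ℤ,
                  a - ℓ < ‖X i - X j - latticeVec L n‖ ∧ ‖X i - X j - latticeVec L n‖ < a + ℓ} ∩ cellN N L,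
                  kineticDensity Ψ X) →
    ∀ (v : ℝ → ℝ≥0∞) (a : ℝ) (M : ℝ≥0∞), IsRepulsiveFiniteRange v → 0 < a →
      (∀ r, 0 ≤ r → r < a → v r = ⊤) → M ≠ ⊤ → (∀ r, a < r → v r ≤ M) →
      ∀ (N : ℕ) (L : ℝ), 4 * a < L → kyFanTwo v N L ≠ ⊤ →
      ∀ ε : ℝ, 0 < ε → ∃ n₀ : ℕ, ∀ n : ℕ, n₀ ≤ n →
        kyFanTwo v N L ≤ kyFanTwo (fun r => min (v r) (n : ℝ≥0∞)) N L + ENNReal.ofReal ε := by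
  intro hpt hshell v a M hv ha hcore hMtop hM N L h4a hK ε hε
  have hL : 0 < L := by linarith
  -- the truncation levels lie below `K = K₂(v)`
  have hKn : ∀ n : ℕ, kyFanTwo (fun r => min (v r) (n : ℝ≥0∞)) N L ≤ kyFanTwo v N L := fun n =>
    kyFanTwo_mono_of_le fun r => min_le_left _ _
  -- `1/(n+1)`-optimal orthogonal pairs of every truncation
  have hpairs : ∀ n : ℕ, ∃ Ψ₁ Ψ₂ : PeriodicTrialState N L, (∫ X in cellN N L, conj (Ψ₁.ψ X) * Ψ₂.ψ X = 0) ∧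
      periodicEnergy (fun r => min (v r) (n : ℝ≥0∞)) Ψ₁ + periodicEnergy (fun r => min (v r) (n : ℝ≥0∞)) Ψ₂ ≤
        kyFanTwo (fun r => min (v r) (n : ℝ≥0∞)) N L + ENNReal.ofReal (1 / ((n : ℝ) + 1)) := fun n =>
    exists_pair_le_add (ne_top_of_le_ne_top hK (hKn n))
      (ENNReal.ofReal_pos.2 (by positivity : (0 : ℝ) < 1 / ((n : ℝ) + 1))).ne'
  choose Ψ₁ Ψ₂ horth hopt using hpairs
  -- the Rellich subsequence with tight pair kinetic energy
  obtain ⟨φ, hφ, hT⟩ := hpt v hv.1 N L hL _ hK Ψ₁ Ψ₂ horth hopt hKn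
  -- the layers, shrinking to the null wall
  set S : ℕ → Set (Config N) := fun kk => {X : Config N | ∃ i j : Fin N, i ≠ j ∧
      ∃ n : Fin 3 → ℤ, a - 1 / ((kk : ℝ) + 1) < ‖X i - X j - latticeVec L n‖ ∧
        ‖X i - X j - latticeVec L n‖ < a + 1 / ((kk : ℝ) + 1)} with hSdef
  have hSm : ∀ kk, MeasurableSet (S kk) := fun kk =>
    measurableSet_pairImage (S := Set.Ioo (a - 1 / ((kk : ℝ) + 1)) (a + 1 / ((kk : ℝ) + 1))) L
      measurableSet_Ioo
  have hSanti : Antitone S := by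
    intro k₁ k₂ hk X hX
    obtain ⟨i, j, hij, n, h1, h2⟩ := hX
    have hmono : (1 : ℝ) / ((k₂ : ℝ) + 1) ≤ 1 / ((k₁ : ℝ) + 1) :=
      one_div_le_one_div_of_le (by positivity) (by exact_mod_cast Nat.succ_le_succ hk)
    exact ⟨i, j, hij, n, by linarith, by linarith⟩
  have hSnull : volume ((⋂ kk, S kk) ∩ cellN N L) = 0 := by
    refine measure_mono_null Set.inter_subset_left ?_
    rw [hSdef, iInter_layer_eq_wall hL a]
    exact volume_wall_eq_zero N L a
  have hT' := hT S hSm hSanti hSnull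
  -- constants of the cut-off and of the shell bound
  obtain ⟨Cχ, hCχ0, hcutℓ⟩ := stub_pairCutoffExists N L a hL ha
  obtain ⟨Cs, hCs0, hshellℓ⟩ := hshell N L a hL ha h4a
  -- the parameters `θ`, `η₀`, `ε₁`
  set Kr : ℝ := (kyFanTwo v N L).toReal with hKrdef
  have hKr : 0 ≤ Kr := ENNReal.toReal_nonneg
  set θ : ℝ := ε / (8 * (Kr + 1)) with hθdef
  have hθ : 0 < θ := by positivity
  have hθK : θ * (8 * (Kr + 1)) ≤ ε := by
    have : θ * (8 * (Kr + 1)) = ε := by rw [hθdef]; field_simp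
    exact this.le
  set η₀ : ℝ := min (1 / 8) (ε / (256 * (1 + θ) * (Kr + 1))) with hη₀def
  have hη₀pos : 0 < η₀ := lt_min (by norm_num) (by positivity)
  have hη₀a : η₀ ≤ 1 / 8 := min_le_left _ _
  have hη₀b : η₀ * (256 * (1 + θ) * (Kr + 1)) ≤ ε := by
    have h := min_le_right (1 / 8 : ℝ) (ε / (256 * (1 + θ) * (Kr + 1)))
    rwa [← hη₀def, le_div_iff₀ (by positivity)] at h
  set ε₁ : ℝ := min (η₀ / (2 * (Cs + 1) * (a ^ 2 + 1))) (ε * θ / (40 * (Cχ * Cs + 1) * (1 + θ))) with hε₁def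
  have hε₁ : 0 < ε₁ := lt_min (by positivity) (by positivity)
  have hε₁a : ε₁ * (2 * (Cs + 1) * (a ^ 2 + 1)) ≤ η₀ := by
    have h := min_le_left (η₀ / (2 * (Cs + 1) * (a ^ 2 + 1))) (ε * θ / (40 * (Cχ * Cs + 1) * (1 + θ)))
    rwa [← hε₁def, le_div_iff₀ (by positivity)] at h
  have hε₁b : ε₁ * (40 * (Cχ * Cs + 1) * (1 + θ)) ≤ ε * θ := by
    have h := min_le_right (η₀ / (2 * (Cs + 1) * (a ^ 2 + 1))) (ε * θ / (40 * (Cχ * Cs + 1) * (1 + θ)))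
    rwa [← hε₁def, le_div_iff₀ (by positivity)] at h
  -- the layer index `k₀`, the subsequence index `i₀`, the shell width `ℓ`, the cut-off `χ`
  obtain ⟨k₀, i₀, hki⟩ := hT' ε₁ hε₁
  set ℓ : ℝ := min a (1 / ((k₀ : ℝ) + 1)) with hℓdef
  have hℓ : 0 < ℓ := lt_min ha (by positivity)
  have hℓa : ℓ ≤ a := min_le_left _ _
  have hℓk : ℓ ≤ 1 / ((k₀ : ℝ) + 1) := min_le_right _ _
  obtain ⟨χ, hχ1, hχper, hχsymm, hχ01, hχ0, hχfar1, hχC, hχfar⟩ := hcutℓ ℓ hℓ hℓa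
  -- the truncation level `m = φ i`
  set R₁ : ℝ := 2 * (1 + Cs) * (Kr + 1) / η₀ with hR₁
  set R₂ : ℝ := 40 * (1 + θ) / ε with hR₂
  set R₃ : ℝ := 80 * (1 + θ) * Cχ * Cs * (Kr + 1) / (ε * θ * ℓ ^ 2) with hR₃
  set i : ℕ := max i₀ (⌈max M.toReal (max R₁ (max R₂ R₃))⌉₊ + 1) with hidef
  have hi₀ : i₀ ≤ i := le_max_left _ _
  have hiR : max M.toReal (max R₁ (max R₂ R₃)) < (i : ℝ) := by
    have h1 : max M.toReal (max R₁ (max R₂ R₃)) ≤ (⌈max M.toReal (max R₁ (max R₂ R₃))⌉₊ : ℝ) := Nat.le_ceil _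
    have h2 : ((⌈max M.toReal (max R₁ (max R₂ R₃))⌉₊ + 1 : ℕ) : ℝ) ≤ (i : ℝ) := by exact_mod_cast le_max_right _ _
    push_cast at h2
    linarith
  have him : (i : ℝ) ≤ (φ i : ℝ) := by exact_mod_cast hφ.le_apply
  have hMR := le_max_left M.toReal (max R₁ (max R₂ R₃))
  have hR₁R := (le_max_left R₁ (max R₂ R₃)).trans (le_max_right M.toReal (max R₁ (max R₂ R₃)))
  have hR₂R := ((le_max_left R₂ R₃).trans (le_max_right R₁ (max R₂ R₃))).trans
    (le_max_right M.toReal (max R₁ (max R₂ R₃)))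
  have hR₃R := ((le_max_right R₂ R₃).trans (le_max_right R₁ (max R₂ R₃))).trans
    (le_max_right M.toReal (max R₁ (max R₂ R₃)))
  have hmpos : (0 : ℝ) < (φ i : ℝ) := by
    have : (0 : ℝ) ≤ M.toReal := ENNReal.toReal_nonneg
    linarith
  have hMm : M ≤ ((φ i : ℕ) : ℝ≥0∞) := by
    have h : M.toReal ≤ ((φ i : ℕ) : ℝ) := by linarith
    calc M = ENNReal.ofReal M.toReal := (ENNReal.ofReal_toReal hMtop).symm
      _ ≤ ENNReal.ofReal ((φ i : ℕ) : ℝ) := ENNReal.ofReal_le_ofReal h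
      _ = ((φ i : ℕ) : ℝ≥0∞) := ENNReal.ofReal_natCast _
  have hm1 : 2 * (1 + Cs) * (Kr + 1) ≤ η₀ * (φ i : ℝ) := by
    have h : R₁ ≤ (φ i : ℝ) := by linarith
    rw [hR₁, div_le_iff₀ hη₀pos] at h
    linarith
  have hm2 : 40 * (1 + θ) ≤ ε * ((φ i : ℝ) + 1) := by
    have h : R₂ ≤ (φ i : ℝ) := by linarith
    rw [hR₂, div_le_iff₀ hε] at h
    nlinarith
  have hm3 : 80 * (1 + θ) * Cχ * Cs * (Kr + 1) ≤ ε * θ * ℓ ^ 2 * (φ i : ℝ) := by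
    have h : R₃ ≤ (φ i : ℝ) := by linarith
    rw [hR₃, div_le_iff₀ (by positivity)] at h
    linarith
  -- the cut states `u_j = χ Ψ_j`, `Ψ_j` the near-optimal pair of the `m`-th truncation
  have hχc1 : ContDiff ℝ 1 (fun Y : Config N => (χ Y : ℂ)) := Complex.ofRealCLM.contDiff.comp hχ1
  have hu : ∀ Φ : PeriodicTrialState N L, ContDiff ℝ 1 (fun Y : Config N => (χ Y : ℂ) * Φ.ψ Y) := fun Φ =>
    hχc1.mul Φ.contDiff
  have huper : ∀ (Φ : PeriodicTrialState N L) (X : Config N) (i' : Fin N) (k' : Fin 3),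
      (fun Y : Config N => (χ Y : ℂ) * Φ.ψ Y) (X + Pi.single i' (EuclideanSpace.single k' L)) =
        (fun Y : Config N => (χ Y : ℂ) * Φ.ψ Y) X := fun Φ X i' k' => by
    simp only [hχper X i' k', Φ.periodic X i' k']
  have husymm : ∀ (Φ : PeriodicTrialState N L) (σ : Equiv.Perm (Fin N)) (X : Config N),
      (fun Y : Config N => (χ Y : ℂ) * Φ.ψ Y) (X ∘ σ) = (fun Y : Config N => (χ Y : ℂ) * Φ.ψ Y) X := fun Φ σ X => by
    simp only [hχsymm σ X, Φ.symm σ X]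
  -- the `ℝ≥0∞` facts, state by state
  have h4E₁ := cutState_form_le (N := N) (L := L) hv.1 hM hMm (Ψ₁ (φ i)) hχ1 hχ01 hχ0 hχC hχfar hθ
  have h4E₂ := cutState_form_le (N := N) (L := L) hv.1 hM hMm (Ψ₂ (φ i)) hχ1 hχ01 hχ0 hχC hχfar hθ
  have h2E₁ := (one_le_mass_cutState_add (N := N) (L := L) (Ψ₁ (φ i)) hχfar1).trans
    (add_le_add_left (add_le_add_right (setLIntegral_hardSet_le_open N L a _) _) _)
  have h2E₂ := (one_le_mass_cutState_add (N := N) (L := L) (Ψ₂ (φ i)) hχfar1).trans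
    (add_le_add_left (add_le_add_right (setLIntegral_hardSet_le_open N L a _) _) _)
  have hμ1₁ := mass_cutState_le_one (N := N) (L := L) (Ψ₁ (φ i)) hχ01
  have hμ1₂ := mass_cutState_le_one (N := N) (L := L) (Ψ₂ (φ i)) hχ01
  have hcoreE₁ := mul_coreMass_le_energy (N := N) (L := L) hcore (φ i) (Ψ₁ (φ i))
  have hcoreE₂ := mul_coreMass_le_energy (N := N) (L := L) hcore (φ i) (Ψ₂ (φ i))
  have hmass1 : ∀ (Φ : PeriodicTrialState N L) (s : Set (Config N)),
      ∫⁻ X in s ∩ cellN N L, ((‖Φ.ψ X‖₊ : ℝ≥0∞)) ^ 2 ≤ 1 := fun Φ s =>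
    (lintegral_mono_set Set.inter_subset_right).trans Φ.norm_eq.le
  have hinnerE : ∀ Φ : PeriodicTrialState N L,
      ∫⁻ X in {X : Config N | ∃ i j : Fin N, i ≠ j ∧ ∃ n : Fin 3 → ℤ,
        a - ℓ < ‖X i - X j - latticeVec L n‖ ∧ ‖X i - X j - latticeVec L n‖ ≤ a} ∩ cellN N L,
        ((‖Φ.ψ X‖₊ : ℝ≥0∞)) ^ 2 ≤
      ∫⁻ X in {X : Config N | ∃ i j : Fin N, i ≠ j ∧ ∃ n : Fin 3 → ℤ,
        ‖X i - X j - latticeVec L n‖ < a} ∩ cellN N L, ((‖Φ.ψ X‖₊ : ℝ≥0∞)) ^ 2 := by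
    intro Φ
    refine le_trans (lintegral_mono_set (Set.inter_subset_inter_left _ ?_))
      (setLIntegral_hardSet_le_open N L a _)
    rintro X ⟨i', j', hij, n, -, h2⟩
    exact ⟨i', j', hij, n, h2⟩
  have hshellE₁ := hshellℓ ℓ hℓ hℓa (Ψ₁ (φ i)).ψ (Ψ₁ (φ i)).contDiff (Ψ₁ (φ i)).periodic
  have hshellE₂ := hshellℓ ℓ hℓ hℓa (Ψ₂ (φ i)).ψ (Ψ₂ (φ i)).contDiff (Ψ₂ (φ i)).periodic
  have hKlE : (∫⁻ X in {X : Config N | ∃ i j : Fin N, i ≠ j ∧ ∃ n : Fin 3 → ℤ,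
        a - ℓ < ‖X i - X j - latticeVec L n‖ ∧ ‖X i - X j - latticeVec L n‖ < a + ℓ} ∩ cellN N L,
        kineticDensity (Ψ₁ (φ i)).ψ X) +
      (∫⁻ X in {X : Config N | ∃ i j : Fin N, i ≠ j ∧ ∃ n : Fin 3 → ℤ,
        a - ℓ < ‖X i - X j - latticeVec L n‖ ∧ ‖X i - X j - latticeVec L n‖ < a + ℓ} ∩ cellN N L,
        kineticDensity (Ψ₂ (φ i)).ψ X) ≤ ENNReal.ofReal ε₁ := by
    rw [← lintegral_add_left (measurable_kineticDensity_of_any _)]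
    refine le_trans (lintegral_mono_set (Set.inter_subset_inter_left _ ?_)) (hki k₀ i le_rfl hi₀)
    rintro X ⟨i', j', hij, n, h1, h2⟩
    exact ⟨i', j', hij, n, by linarith, by linarith⟩
  have hovE := stub_cutStatesOverlap N L a ℓ χ hχ1.continuous hχ01 hχfar1 (Ψ₁ (φ i)) (Ψ₂ (φ i)) (horth (φ i))
  -- aggregated facts (sums over the two states)
  have hE : periodicEnergy (fun r => min (v r) ((φ i : ℕ) : ℝ≥0∞)) (Ψ₁ (φ i)) + periodicEnergy (fun r => min (v r) ((φ i : ℕ) : ℝ≥0∞)) (Ψ₂ (φ i)) ≤ kyFanTwo v N L + 1 :=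
    (hopt (φ i)).trans (add_le_add (hKn (φ i)) (by
      rw [← ENNReal.ofReal_one]
      exact ENNReal.ofReal_le_ofReal (by rw [div_le_one (by positivity)]; linarith)))
  have hcoreA : ((φ i : ℕ) : ℝ≥0∞) * ((∫⁻ X in {X : Config N | ∃ i j : Fin N, i ≠ j ∧ ∃ n : Fin 3 → ℤ,
        ‖X i - X j - latticeVec L n‖ < a} ∩ cellN N L, ((‖(Ψ₁ (φ i)).ψ X‖₊ : ℝ≥0∞)) ^ 2) + (∫⁻ X in {X : Config N | ∃ i j : Fin N, i ≠ j ∧ ∃ n : Fin 3 → ℤ,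
        ‖X i - X j - latticeVec L n‖ < a} ∩ cellN N L, ((‖(Ψ₂ (φ i)).ψ X‖₊ : ℝ≥0∞)) ^ 2)) ≤ periodicEnergy (fun r => min (v r) ((φ i : ℕ) : ℝ≥0∞)) (Ψ₁ (φ i)) + periodicEnergy (fun r => min (v r) ((φ i : ℕ) : ℝ≥0∞)) (Ψ₂ (φ i)) := by
    rw [mul_add]; exact add_le_add hcoreE₁ hcoreE₂
  have hinnerA : (∫⁻ X in {X : Config N | ∃ i j : Fin N, i ≠ j ∧ ∃ n : Fin 3 → ℤ,
        a - ℓ < ‖X i - X j - latticeVec L n‖ ∧ ‖X i - X j - latticeVec L n‖ ≤ a} ∩ cellN N L, ((‖(Ψ₁ (φ i)).ψ X‖₊ : ℝ≥0∞)) ^ 2) + (∫⁻ X in {X : Config N | ∃ i j : Fin N, i ≠ j ∧ ∃ n : Fin 3 → ℤ,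
        a - ℓ < ‖X i - X j - latticeVec L n‖ ∧ ‖X i - X j - latticeVec L n‖ ≤ a} ∩ cellN N L, ((‖(Ψ₂ (φ i)).ψ X‖₊ : ℝ≥0∞)) ^ 2) ≤ (∫⁻ X in {X : Config N | ∃ i j : Fin N, i ≠ j ∧ ∃ n : Fin 3 → ℤ,
        ‖X i - X j - latticeVec L n‖ < a} ∩ cellN N L, ((‖(Ψ₁ (φ i)).ψ X‖₊ : ℝ≥0∞)) ^ 2) + (∫⁻ X in {X : Config N | ∃ i j : Fin N, i ≠ j ∧ ∃ n : Fin 3 → ℤ,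
        ‖X i - X j - latticeVec L n‖ < a} ∩ cellN N L, ((‖(Ψ₂ (φ i)).ψ X‖₊ : ℝ≥0∞)) ^ 2) :=
    add_le_add (hinnerE _) (hinnerE _)
  have hshellA : (∫⁻ X in {X : Config N | ∃ i j : Fin N, i ≠ j ∧ ∃ n : Fin 3 → ℤ,
        a < ‖X i - X j - latticeVec L n‖ ∧ ‖X i - X j - latticeVec L n‖ < a + ℓ} ∩ cellN N L, ((‖(Ψ₁ (φ i)).ψ X‖₊ : ℝ≥0∞)) ^ 2) + (∫⁻ X in {X : Config N | ∃ i j : Fin N, i ≠ j ∧ ∃ n : Fin 3 → ℤ,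
        a < ‖X i - X j - latticeVec L n‖ ∧ ‖X i - X j - latticeVec L n‖ < a + ℓ} ∩ cellN N L, ((‖(Ψ₂ (φ i)).ψ X‖₊ : ℝ≥0∞)) ^ 2) ≤
      ENNReal.ofReal Cs * ((∫⁻ X in {X : Config N | ∃ i j : Fin N, i ≠ j ∧ ∃ n : Fin 3 → ℤ,
        a - ℓ < ‖X i - X j - latticeVec L n‖ ∧ ‖X i - X j - latticeVec L n‖ ≤ a} ∩ cellN N L, ((‖(Ψ₁ (φ i)).ψ X‖₊ : ℝ≥0∞)) ^ 2) + (∫⁻ X in {X : Config N | ∃ i j : Fin N, i ≠ j ∧ ∃ n : Fin 3 → ℤ,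
        a - ℓ < ‖X i - X j - latticeVec L n‖ ∧ ‖X i - X j - latticeVec L n‖ ≤ a} ∩ cellN N L, ((‖(Ψ₂ (φ i)).ψ X‖₊ : ℝ≥0∞)) ^ 2)) + ENNReal.ofReal (Cs * ℓ ^ 2) * ((∫⁻ X in {X : Config N | ∃ i j : Fin N, i ≠ j ∧ ∃ n : Fin 3 → ℤ,
        a - ℓ < ‖X i - X j - latticeVec L n‖ ∧ ‖X i - X j - latticeVec L n‖ < a + ℓ} ∩ cellN N L,
        kineticDensity (Ψ₁ (φ i)).ψ X) + (∫⁻ X in {X : Config N | ∃ i j : Fin N, i ≠ j ∧ ∃ n : Fin 3 → ℤ,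
        a - ℓ < ‖X i - X j - latticeVec L n‖ ∧ ‖X i - X j - latticeVec L n‖ < a + ℓ} ∩ cellN N L,
        kineticDensity (Ψ₂ (φ i)).ψ X)) :=
    calc _ ≤ _ := add_le_add hshellE₁ hshellE₂
      _ = _ := by ring
  have h112 : (1 : ℝ≥0∞) + 1 = 2 := by norm_num
  have hmK2 :
      (∫⁻ X in {X : Config N | ∃ i j : Fin N, i ≠ j ∧ ∃ n : Fin 3 → ℤ,
        ‖X i - X j - latticeVec L n‖ < a} ∩ cellN N L, ((‖(Ψ₁ (φ i)).ψ X‖₊ : ℝ≥0∞)) ^ 2) + (∫⁻ X in {X : Config N | ∃ i j : Fin N, i ≠ j ∧ ∃ n : Fin 3 → ℤ,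
        ‖X i - X j - latticeVec L n‖ < a} ∩ cellN N L, ((‖(Ψ₂ (φ i)).ψ X‖₊ : ℝ≥0∞)) ^ 2) ≤ 2 := (add_le_add (hmass1 _ _) (hmass1 _ _)).trans_eq h112
  have hmO2 : (∫⁻ X in {X : Config N | ∃ i j : Fin N, i ≠ j ∧ ∃ n : Fin 3 → ℤ,
        a < ‖X i - X j - latticeVec L n‖ ∧ ‖X i - X j - latticeVec L n‖ < a + ℓ} ∩ cellN N L, ((‖(Ψ₁ (φ i)).ψ X‖₊ : ℝ≥0∞)) ^ 2) + (∫⁻ X in {X : Config N | ∃ i j : Fin N, i ≠ j ∧ ∃ n : Fin 3 → ℤ,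
        a < ‖X i - X j - latticeVec L n‖ ∧ ‖X i - X j - latticeVec L n‖ < a + ℓ} ∩ cellN N L, ((‖(Ψ₂ (φ i)).ψ X‖₊ : ℝ≥0∞)) ^ 2) ≤ 2 := (add_le_add (hmass1 _ _) (hmass1 _ _)).trans_eq h112
  -- the lost mass `η`
  have hηfin : (∫⁻ X in {X : Config N | ∃ i j : Fin N, i ≠ j ∧ ∃ n : Fin 3 → ℤ,
        ‖X i - X j - latticeVec L n‖ < a} ∩ cellN N L, ((‖(Ψ₁ (φ i)).ψ X‖₊ : ℝ≥0∞)) ^ 2) + (∫⁻ X in {X : Config N | ∃ i j : Fin N, i ≠ j ∧ ∃ n : Fin 3 → ℤ,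
        ‖X i - X j - latticeVec L n‖ < a} ∩ cellN N L, ((‖(Ψ₂ (φ i)).ψ X‖₊ : ℝ≥0∞)) ^ 2) + ((∫⁻ X in {X : Config N | ∃ i j : Fin N, i ≠ j ∧ ∃ n : Fin 3 → ℤ,
        a < ‖X i - X j - latticeVec L n‖ ∧ ‖X i - X j - latticeVec L n‖ < a + ℓ} ∩ cellN N L, ((‖(Ψ₁ (φ i)).ψ X‖₊ : ℝ≥0∞)) ^ 2) + (∫⁻ X in {X : Config N | ∃ i j : Fin N, i ≠ j ∧ ∃ n : Fin 3 → ℤ,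
        a < ‖X i - X j - latticeVec L n‖ ∧ ‖X i - X j - latticeVec L n‖ < a + ℓ} ∩ cellN N L, ((‖(Ψ₂ (φ i)).ψ X‖₊ : ℝ≥0∞)) ^ 2)) ≠ ⊤ :=
    ENNReal.add_ne_top.2 ⟨ne_top_of_le_ne_top ENNReal.ofNat_ne_top hmK2, ne_top_of_le_ne_top ENNReal.ofNat_ne_top hmO2⟩
  set η : ℝ := ((∫⁻ X in {X : Config N | ∃ i j : Fin N, i ≠ j ∧ ∃ n : Fin 3 → ℤ,
        ‖X i - X j - latticeVec L n‖ < a} ∩ cellN N L, ((‖(Ψ₁ (φ i)).ψ X‖₊ : ℝ≥0∞)) ^ 2) + (∫⁻ X in {X : Config N | ∃ i j : Fin N, i ≠ j ∧ ∃ n : Fin 3 → ℤ,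
        ‖X i - X j - latticeVec L n‖ < a} ∩ cellN N L, ((‖(Ψ₂ (φ i)).ψ X‖₊ : ℝ≥0∞)) ^ 2) + ((∫⁻ X in {X : Config N | ∃ i j : Fin N, i ≠ j ∧ ∃ n : Fin 3 → ℤ,
        a < ‖X i - X j - latticeVec L n‖ ∧ ‖X i - X j - latticeVec L n‖ < a + ℓ} ∩ cellN N L, ((‖(Ψ₁ (φ i)).ψ X‖₊ : ℝ≥0∞)) ^ 2) + (∫⁻ X in {X : Config N | ∃ i j : Fin N, i ≠ j ∧ ∃ n : Fin 3 → ℤ,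
        a < ‖X i - X j - latticeVec L n‖ ∧ ‖X i - X j - latticeVec L n‖ < a + ℓ} ∩ cellN N L, ((‖(Ψ₂ (φ i)).ψ X‖₊ : ℝ≥0∞)) ^ 2))).toReal with hηdef
  have hη0 : 0 ≤ η := ENNReal.toReal_nonneg
  have hηle : η ≤ η₀ :=
    eta_bound_ennreal hK hE hCs0 hℓ hℓa hmpos hε₁ hmK2 hmO2 hcoreA hinnerA hshellA hKlE hm1 hε₁a
  have hη8 : η ≤ 1 / 8 := hηle.trans hη₀a
  have hηE : ENNReal.ofReal η = (∫⁻ X in {X : Config N | ∃ i j : Fin N, i ≠ j ∧ ∃ n : Fin 3 → ℤ,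
        ‖X i - X j - latticeVec L n‖ < a} ∩ cellN N L, ((‖(Ψ₁ (φ i)).ψ X‖₊ : ℝ≥0∞)) ^ 2) + (∫⁻ X in {X : Config N | ∃ i j : Fin N, i ≠ j ∧ ∃ n : Fin 3 → ℤ,
        ‖X i - X j - latticeVec L n‖ < a} ∩ cellN N L, ((‖(Ψ₂ (φ i)).ψ X‖₊ : ℝ≥0∞)) ^ 2) + ((∫⁻ X in {X : Config N | ∃ i j : Fin N, i ≠ j ∧ ∃ n : Fin 3 → ℤ,
        a < ‖X i - X j - latticeVec L n‖ ∧ ‖X i - X j - latticeVec L n‖ < a + ℓ} ∩ cellN N L, ((‖(Ψ₁ (φ i)).ψ X‖₊ : ℝ≥0∞)) ^ 2) + (∫⁻ X in {X : Config N | ∃ i j : Fin N, i ≠ j ∧ ∃ n : Fin 3 → ℤ,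
        a < ‖X i - X j - latticeVec L n‖ ∧ ‖X i - X j - latticeVec L n‖ < a + ℓ} ∩ cellN N L, ((‖(Ψ₂ (φ i)).ψ X‖₊ : ℝ≥0∞)) ^ 2)) := ENNReal.ofReal_toReal hηfin
  -- the Gram–Schmidt hypotheses
  have hlow : ∀ ⦃μ mKj mOj : ℝ≥0∞⦄, 1 ≤ μ + mKj + mOj → mKj + mOj ≤ ENNReal.ofReal η → ENNReal.ofReal (1 - η) ≤ μ := by
    intro μ mKj mOj h1 h2
    rw [ENNReal.ofReal_sub _ hη0, ENNReal.ofReal_one]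
    refine tsub_le_iff_right.2 ?_
    calc (1 : ℝ≥0∞) ≤ μ + mKj + mOj := h1
      _ = μ + (mKj + mOj) := add_assoc _ _ _
      _ ≤ μ + ENNReal.ofReal η := add_le_add le_rfl h2
  have hpart₁ : (∫⁻ X in {X : Config N | ∃ i j : Fin N, i ≠ j ∧ ∃ n : Fin 3 → ℤ,
        ‖X i - X j - latticeVec L n‖ < a} ∩ cellN N L, ((‖(Ψ₁ (φ i)).ψ X‖₊ : ℝ≥0∞)) ^ 2) + (∫⁻ X in {X : Config N | ∃ i j : Fin N, i ≠ j ∧ ∃ n : Fin 3 → ℤ,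
        a < ‖X i - X j - latticeVec L n‖ ∧ ‖X i - X j - latticeVec L n‖ < a + ℓ} ∩ cellN N L, ((‖(Ψ₁ (φ i)).ψ X‖₊ : ℝ≥0∞)) ^ 2) ≤ ENNReal.ofReal η := by
    rw [hηE]
    calc (∫⁻ X in {X : Config N | ∃ i j : Fin N, i ≠ j ∧ ∃ n : Fin 3 → ℤ,
        ‖X i - X j - latticeVec L n‖ < a} ∩ cellN N L, ((‖(Ψ₁ (φ i)).ψ X‖₊ : ℝ≥0∞)) ^ 2) + (∫⁻ X in {X : Config N | ∃ i j : Fin N, i ≠ j ∧ ∃ n : Fin 3 → ℤ,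
        a < ‖X i - X j - latticeVec L n‖ ∧ ‖X i - X j - latticeVec L n‖ < a + ℓ} ∩ cellN N L, ((‖(Ψ₁ (φ i)).ψ X‖₊ : ℝ≥0∞)) ^ 2) ≤ ((∫⁻ X in {X : Config N | ∃ i j : Fin N, i ≠ j ∧ ∃ n : Fin 3 → ℤ,
        ‖X i - X j - latticeVec L n‖ < a} ∩ cellN N L, ((‖(Ψ₁ (φ i)).ψ X‖₊ : ℝ≥0∞)) ^ 2) + (∫⁻ X in {X : Config N | ∃ i j : Fin N, i ≠ j ∧ ∃ n : Fin 3 → ℤ,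
        ‖X i - X j - latticeVec L n‖ < a} ∩ cellN N L, ((‖(Ψ₂ (φ i)).ψ X‖₊ : ℝ≥0∞)) ^ 2)) + ((∫⁻ X in {X : Config N | ∃ i j : Fin N, i ≠ j ∧ ∃ n : Fin 3 → ℤ,
        a < ‖X i - X j - latticeVec L n‖ ∧ ‖X i - X j - latticeVec L n‖ < a + ℓ} ∩ cellN N L, ((‖(Ψ₁ (φ i)).ψ X‖₊ : ℝ≥0∞)) ^ 2) + (∫⁻ X in {X : Config N | ∃ i j : Fin N, i ≠ j ∧ ∃ n : Fin 3 → ℤ,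
        a < ‖X i - X j - latticeVec L n‖ ∧ ‖X i - X j - latticeVec L n‖ < a + ℓ} ∩ cellN N L, ((‖(Ψ₂ (φ i)).ψ X‖₊ : ℝ≥0∞)) ^ 2)) := add_le_add le_self_add le_self_add
      _ = _ := rfl
  have hpart₂ : (∫⁻ X in {X : Config N | ∃ i j : Fin N, i ≠ j ∧ ∃ n : Fin 3 → ℤ,
        ‖X i - X j - latticeVec L n‖ < a} ∩ cellN N L, ((‖(Ψ₂ (φ i)).ψ X‖₊ : ℝ≥0∞)) ^ 2) + (∫⁻ X in {X : Config N | ∃ i j : Fin N, i ≠ j ∧ ∃ n : Fin 3 → ℤ,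
        a < ‖X i - X j - latticeVec L n‖ ∧ ‖X i - X j - latticeVec L n‖ < a + ℓ} ∩ cellN N L, ((‖(Ψ₂ (φ i)).ψ X‖₊ : ℝ≥0∞)) ^ 2) ≤ ENNReal.ofReal η := by
    rw [hηE]
    calc (∫⁻ X in {X : Config N | ∃ i j : Fin N, i ≠ j ∧ ∃ n : Fin 3 → ℤ,
        ‖X i - X j - latticeVec L n‖ < a} ∩ cellN N L, ((‖(Ψ₂ (φ i)).ψ X‖₊ : ℝ≥0∞)) ^ 2) + (∫⁻ X in {X : Config N | ∃ i j : Fin N, i ≠ j ∧ ∃ n : Fin 3 → ℤ,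
        a < ‖X i - X j - latticeVec L n‖ ∧ ‖X i - X j - latticeVec L n‖ < a + ℓ} ∩ cellN N L, ((‖(Ψ₂ (φ i)).ψ X‖₊ : ℝ≥0∞)) ^ 2) ≤ ((∫⁻ X in {X : Config N | ∃ i j : Fin N, i ≠ j ∧ ∃ n : Fin 3 → ℤ,
        ‖X i - X j - latticeVec L n‖ < a} ∩ cellN N L, ((‖(Ψ₁ (φ i)).ψ X‖₊ : ℝ≥0∞)) ^ 2) + (∫⁻ X in {X : Config N | ∃ i j : Fin N, i ≠ j ∧ ∃ n : Fin 3 → ℤ,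
        ‖X i - X j - latticeVec L n‖ < a} ∩ cellN N L, ((‖(Ψ₂ (φ i)).ψ X‖₊ : ℝ≥0∞)) ^ 2)) + ((∫⁻ X in {X : Config N | ∃ i j : Fin N, i ≠ j ∧ ∃ n : Fin 3 → ℤ,
        a < ‖X i - X j - latticeVec L n‖ ∧ ‖X i - X j - latticeVec L n‖ < a + ℓ} ∩ cellN N L, ((‖(Ψ₁ (φ i)).ψ X‖₊ : ℝ≥0∞)) ^ 2) + (∫⁻ X in {X : Config N | ∃ i j : Fin N, i ≠ j ∧ ∃ n : Fin 3 → ℤ,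
        a < ‖X i - X j - latticeVec L n‖ ∧ ‖X i - X j - latticeVec L n‖ < a + ℓ} ∩ cellN N L, ((‖(Ψ₂ (φ i)).ψ X‖₊ : ℝ≥0∞)) ^ 2)) := add_le_add le_add_self le_add_self
      _ = _ := rfl
  have hlow₁ := hlow h2E₁ hpart₁
  have hlow₂ := hlow h2E₂ hpart₂
  have hup : ∀ ⦃μ : ℝ≥0∞⦄, μ ≤ 1 → μ ≤ ENNReal.ofReal (1 + η) := by
    intro μ h
    exact h.trans (by rw [← ENNReal.ofReal_one]; exact ENNReal.ofReal_le_ofReal (by linarith))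
  have hovη : ‖∫ X in cellN N L, conj ((χ X : ℂ) * (Ψ₁ (φ i)).ψ X) * ((χ X : ℂ) * (Ψ₂ (φ i)).ψ X)‖ ≤ η := by
    have hc : (∫⁻ X in {X : Config N | ∃ i j : Fin N, i ≠ j ∧ ∃ n : Fin 3 → ℤ,
        ‖X i - X j - latticeVec L n‖ ≤ a} ∩ cellN N L, ((‖(Ψ₁ (φ i)).ψ X‖₊ : ℝ≥0∞)) ^ 2) + (∫⁻ X in {X : Config N | ∃ i j : Fin N, i ≠ j ∧ ∃ n : Fin 3 → ℤ,
        a < ‖X i - X j - latticeVec L n‖ ∧ ‖X i - X j - latticeVec L n‖ < a + ℓ} ∩ cellN N L, ((‖(Ψ₁ (φ i)).ψ X‖₊ : ℝ≥0∞)) ^ 2) + (∫⁻ X in {X : Config N | ∃ i j : Fin N, i ≠ j ∧ ∃ n : Fin 3 → ℤ,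
        ‖X i - X j - latticeVec L n‖ ≤ a} ∩ cellN N L, ((‖(Ψ₂ (φ i)).ψ X‖₊ : ℝ≥0∞)) ^ 2) + (∫⁻ X in {X : Config N | ∃ i j : Fin N, i ≠ j ∧ ∃ n : Fin 3 → ℤ,
        a < ‖X i - X j - latticeVec L n‖ ∧ ‖X i - X j - latticeVec L n‖ < a + ℓ} ∩ cellN N L, ((‖(Ψ₂ (φ i)).ψ X‖₊ : ℝ≥0∞)) ^ 2) ≤ (∫⁻ X in {X : Config N | ∃ i j : Fin N, i ≠ j ∧ ∃ n : Fin 3 → ℤ,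
        ‖X i - X j - latticeVec L n‖ < a} ∩ cellN N L, ((‖(Ψ₁ (φ i)).ψ X‖₊ : ℝ≥0∞)) ^ 2) + (∫⁻ X in {X : Config N | ∃ i j : Fin N, i ≠ j ∧ ∃ n : Fin 3 → ℤ,
        ‖X i - X j - latticeVec L n‖ < a} ∩ cellN N L, ((‖(Ψ₂ (φ i)).ψ X‖₊ : ℝ≥0∞)) ^ 2) + ((∫⁻ X in {X : Config N | ∃ i j : Fin N, i ≠ j ∧ ∃ n : Fin 3 → ℤ,
        a < ‖X i - X j - latticeVec L n‖ ∧ ‖X i - X j - latticeVec L n‖ < a + ℓ} ∩ cellN N L, ((‖(Ψ₁ (φ i)).ψ X‖₊ : ℝ≥0∞)) ^ 2) + (∫⁻ X in {X : Config N | ∃ i j : Fin N, i ≠ j ∧ ∃ n : Fin 3 → ℤ,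
        a < ‖X i - X j - latticeVec L n‖ ∧ ‖X i - X j - latticeVec L n‖ < a + ℓ} ∩ cellN N L, ((‖(Ψ₂ (φ i)).ψ X‖₊ : ℝ≥0∞)) ^ 2)) :=
      calc _ ≤ _ :=
            add_le_add (add_le_add (add_le_add (setLIntegral_hardSet_le_open N L a _) le_rfl)
              (setLIntegral_hardSet_le_open N L a _)) le_rfl
        _ = _ := by ring
    have h1 : ((∫⁻ X in {X : Config N | ∃ i j : Fin N, i ≠ j ∧ ∃ n : Fin 3 → ℤ,
        ‖X i - X j - latticeVec L n‖ ≤ a} ∩ cellN N L, ((‖(Ψ₁ (φ i)).ψ X‖₊ : ℝ≥0∞)) ^ 2) + (∫⁻ X in {X : Config N | ∃ i j : Fin N, i ≠ j ∧ ∃ n : Fin 3 → ℤ,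
        a < ‖X i - X j - latticeVec L n‖ ∧ ‖X i - X j - latticeVec L n‖ < a + ℓ} ∩ cellN N L, ((‖(Ψ₁ (φ i)).ψ X‖₊ : ℝ≥0∞)) ^ 2) + (∫⁻ X in {X : Config N | ∃ i j : Fin N, i ≠ j ∧ ∃ n : Fin 3 → ℤ,
        ‖X i - X j - latticeVec L n‖ ≤ a} ∩ cellN N L, ((‖(Ψ₂ (φ i)).ψ X‖₊ : ℝ≥0∞)) ^ 2) + (∫⁻ X in {X : Config N | ∃ i j : Fin N, i ≠ j ∧ ∃ n : Fin 3 → ℤ,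
        a < ‖X i - X j - latticeVec L n‖ ∧ ‖X i - X j - latticeVec L n‖ < a + ℓ} ∩ cellN N L, ((‖(Ψ₂ (φ i)).ψ X‖₊ : ℝ≥0∞)) ^ 2)).toReal ≤ η := by
      rw [hηdef]; exact ENNReal.toReal_mono hηfin hc
    have h2 : 0 ≤ ((∫⁻ X in {X : Config N | ∃ i j : Fin N, i ≠ j ∧ ∃ n : Fin 3 → ℤ,
        ‖X i - X j - latticeVec L n‖ ≤ a} ∩ cellN N L, ((‖(Ψ₁ (φ i)).ψ X‖₊ : ℝ≥0∞)) ^ 2) + (∫⁻ X in {X : Config N | ∃ i j : Fin N, i ≠ j ∧ ∃ n : Fin 3 → ℤ,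
        a < ‖X i - X j - latticeVec L n‖ ∧ ‖X i - X j - latticeVec L n‖ < a + ℓ} ∩ cellN N L, ((‖(Ψ₁ (φ i)).ψ X‖₊ : ℝ≥0∞)) ^ 2) + (∫⁻ X in {X : Config N | ∃ i j : Fin N, i ≠ j ∧ ∃ n : Fin 3 → ℤ,
        ‖X i - X j - latticeVec L n‖ ≤ a} ∩ cellN N L, ((‖(Ψ₂ (φ i)).ψ X‖₊ : ℝ≥0∞)) ^ 2) + (∫⁻ X in {X : Config N | ∃ i j : Fin N, i ≠ j ∧ ∃ n : Fin 3 → ℤ,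
        a < ‖X i - X j - latticeVec L n‖ ∧ ‖X i - X j - latticeVec L n‖ < a + ℓ} ∩ cellN N L, ((‖(Ψ₂ (φ i)).ψ X‖₊ : ℝ≥0∞)) ^ 2)).toReal := ENNReal.toReal_nonneg
    refine hovE.trans ?_
    linarith
  obtain ⟨f₁, f₂, hforth, hfE⟩ := stub_gramSchmidtPair v hv.1 N L hL η hη0 hη8 _ _ (hu _) (hu _) (huper _) (huper _)
    (husymm _) (husymm _) hlow₁ (hup hμ1₁) hlow₂ (hup hμ1₂) hovη
  -- the variational principle for `K₂(v)` and the final bookkeeping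
  have hKf : kyFanTwo v N L ≤ periodicEnergy v f₁ + periodicEnergy v f₂ :=
    iInf_le_of_le f₁ (iInf_le_of_le f₂ (iInf_le_of_le hforth le_rfl))
  have hGSE := hKf.trans hfE
  have hq : (∫⁻ X in cellN N L, kineticDensity (fun Y => (χ Y : ℂ) * (Ψ₁ (φ i)).ψ Y) X +
        periodicInteraction v L X * ((‖(χ X : ℂ) * (Ψ₁ (φ i)).ψ X‖₊ : ℝ≥0∞)) ^ 2) + (∫⁻ X in cellN N L, kineticDensity (fun Y => (χ Y : ℂ) * (Ψ₂ (φ i)).ψ Y) X +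
        periodicInteraction v L X * ((‖(χ X : ℂ) * (Ψ₂ (φ i)).ψ X‖₊ : ℝ≥0∞)) ^ 2) ≤
      ENNReal.ofReal (1 + θ) * (periodicEnergy (fun r => min (v r) ((φ i : ℕ) : ℝ≥0∞)) (Ψ₁ (φ i)) + periodicEnergy (fun r => min (v r) ((φ i : ℕ) : ℝ≥0∞)) (Ψ₂ (φ i))) + ENNReal.ofReal ((1 + θ⁻¹) * (Cχ / ℓ ^ 2)) * ((∫⁻ X in {X : Config N | ∃ i j : Fin N, i ≠ j ∧ ∃ n : Fin 3 → ℤ,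
        a < ‖X i - X j - latticeVec L n‖ ∧ ‖X i - X j - latticeVec L n‖ < a + ℓ} ∩ cellN N L, ((‖(Ψ₁ (φ i)).ψ X‖₊ : ℝ≥0∞)) ^ 2) + (∫⁻ X in {X : Config N | ∃ i j : Fin N, i ≠ j ∧ ∃ n : Fin 3 → ℤ,
        a < ‖X i - X j - latticeVec L n‖ ∧ ‖X i - X j - latticeVec L n‖ < a + ℓ} ∩ cellN N L, ((‖(Ψ₂ (φ i)).ψ X‖₊ : ℝ≥0∞)) ^ 2)) :=
    calc _ ≤ _ := add_le_add h4E₁ h4E₂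
      _ = _ := by ring
  have key : kyFanTwo v N L ≤ kyFanTwo (fun r => min (v r) ((φ i : ℕ) : ℝ≥0∞)) N L + ENNReal.ofReal ε :=
    final_ennreal hK (hKn (φ i)) hθ hη0 hηle hη₀a hCs0 hCχ0 hℓ hmpos hε hε₁ hmK2 hmO2 hGSE hq (hopt (φ i)) hcoreA hinnerA
      hshellA hKlE hθK hη₀b hm2 hm3 hε₁b
  -- monotonicity in the truncation level
  refine ⟨φ i, fun n hn => key.trans ?_⟩
  have hmn : ((φ i : ℕ) : ℝ≥0∞) ≤ (n : ℝ≥0∞) := by exact_mod_cast hn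
  exact add_le_add_left (kyFanTwo_mono_of_le fun r => min_le_min_left (v r) hmn) _


end Summit.AtomisticToContinuum.BoseEinsteinCondensation.Cruxes.HardCoreExtension.ThirdLawCurrentFloor

end
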